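import Summits.CriticalPhenomena.Ising3DConformalLimit.Theses.LogPolarProxy
import Summits.CriticalPhenomena.Ising3DConformalLimit.Theses.ReflectionTwin
import Summits.CriticalPhenomena.Ising3DConformalLimit.Theses.HyperoctahedralRP
import Summits.CriticalPhenomena.Ising3DConformalLimit.Theorems.MoebiusLimitExists.Negative.MeshContinuity
import HarnessLib

/-!
# Stub `stub_limitContinuity` of crux `ExistsContinuousLimit` (stmt-CriticalPhenomena-4582), line `birth`

Support file for the crux `LogPolarProxy.ExistsContinuousLimit` (item stmt-CriticalPhenomena-4582, shared
verbatim with `ReflectionTwin.ExistsContinuousLimit`), sub-problem `Ising3DConformalLimit`, line `birth`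
(`Cruxes/ExistsContinuousLimit/Lines/birth.lean`): it proves the registered stub `stub_limitContinuity`
(S2, "a priori regularity of the critical Ising scaling limit"), the second hypothesis of the sorry-free
composition `ExistsContinuousLimit_of : S1 → S2 → ExistsContinuousLimit`.

**The stub is free of Ising input.** `HasPointwiseScalingLimit G ρ S` is locally uniform convergence,
as `δ → 0⁺` through ALL small meshes, of functions constant on the origin-anchored `δ`-cells; for two
nearby configurations none of whose coordinates vanishes there is a good mesh `δ < δ₀` putting every
coordinate pair in a common cell, so the limit is continuous there ("mesh continuity"), and the
coordinate hyperplanes are removed by the FREE translation invariance of every pointwise limit of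
`criticalCorr 3`. All of this is the landed tree theorem
`LimitMeshContinuity.continuousOn_limit` (file `Theorems/MoebiusLimitExists/Negative/MeshContinuity.lean`,
sibling crux stmt-CriticalPhenomena-1344); the present stub is its specialisation, with the idle
hypotheses (`ρ > 0`, `0 < Δ`, normalisation, non-degeneracy, translation invariance, scale covariance)
of the registered signature discarded. (The line card's "counterexample"
`S₂ = ‖y−x‖^{-2Δ}(1 + 1_{(y−x)₁ ≥ 0})` is not a locally uniform limit of its own discretisation near
`(y−x)₁ = 0`: pairs with `y₁ < x₁` in a common `δ`-cell keep an `O(1)` defect for every `δ`.)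

Consequence recorded here for the planners: **the crux is EQUIVALENT to the shared existence item
stmt-CriticalPhenomena-1981** (`existsContinuousLimit_iff_existsScaleCovariantLimit`, and the same for the
`ReflectionTwin` copy): the continuity clause adds nothing, so stmt-4582 closes the moment stmt-1981 does
and not before.
-/

noncomputable section

namespace Summit.CriticalPhenomena.Ising3DConformalLimit.LogPolarProxyExistsContinuousLimit

open Literature.Probability.LatticeModels

/-- **Stub `stub_limitContinuity` (S2) of line `birth`, crux `ExistsContinuousLimit`
(stmt-CriticalPhenomena-4582), registered signature verbatim**: every pointwise scaling limit `S` of the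
critical `ℤ³` Ising correlators `criticalCorr 3` along a renormalisation `ρ > 0` on `(0,1]` — here also
assumed normalised off `NonCoincident`, non-degenerate, translation invariant and `Δ`-scale covariant with
`Δ > 0`, although none of these is used — is continuous on the non-coincident configurations,
`ContinuousOn (S n) (NonCoincident 3 n)` for every `n`. Immediate from mesh continuity
(`LimitMeshContinuity.continuousOn_limit`). -/
theorem stub_limitContinuity :
    ∀ (ρ : ℝ → ℝ) (Δ : ℝ) (S : Literature.Probability.LatticeModels.CorrFamily 3),
      (∀ δ ∈ Set.Ioc (0:ℝ) 1, 0 < ρ δ) → 0 < Δ →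
      Literature.Probability.LatticeModels.HasPointwiseScalingLimit
        (Literature.Probability.LatticeModels.criticalCorr 3) ρ S →
      (∀ n z, z ∉ Literature.Probability.LatticeModels.NonCoincident 3 n → S n z = 0) →
      Literature.Probability.LatticeModels.IsNondegenerateTwoPoint S →
      Literature.Probability.LatticeModels.IsTranslationInvariant S →
      Literature.Probability.LatticeModels.IsScaleCovariant Δ S →
      ∀ n, ContinuousOn (S n) (Literature.Probability.LatticeModels.NonCoincident 3 n) := by
  intro ρ _Δ S _hρ _hΔ hlim _hzero _hnd _htr _hsc n
  exact Summit.CriticalPhenomena.Ising3DConformalLimit.LimitMeshContinuity.continuousOn_limit hlim n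

/-- **The shared existence item gives the crux**: `HyperoctahedralRP.ExistsScaleCovariantLimit`
(stmt-CriticalPhenomena-1981) implies `LogPolarProxy.ExistsContinuousLimit` (stmt-CriticalPhenomena-4582) —
the continuity clause is supplied by `stub_limitContinuity`. -/
theorem existsContinuousLimit_of_existsScaleCovariantLimit
    (h : Summit.CriticalPhenomena.Ising3DConformalLimit.Theses.HyperoctahedralRP.ExistsScaleCovariantLimit) :
    Summit.CriticalPhenomena.Ising3DConformalLimit.Theses.LogPolarProxy.ExistsContinuousLimit := by
  obtain ⟨ρ, Δ, S, hρ, hΔ, hlim, hzero, hnd, htr, hsc⟩ := h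
  exact ⟨ρ, Δ, S, hρ, hΔ, hlim, hzero,
    stub_limitContinuity ρ Δ S hρ hΔ hlim hzero hnd htr hsc, hnd, htr, hsc⟩

/-- **The crux is equivalent to the shared existence item**:
`LogPolarProxy.ExistsContinuousLimit ↔ HyperoctahedralRP.ExistsScaleCovariantLimit`
(stmt-CriticalPhenomena-4582 ⟺ stmt-CriticalPhenomena-1981); the converse direction just forgets the
continuity clause. -/
theorem existsContinuousLimit_iff_existsScaleCovariantLimit :
    Summit.CriticalPhenomena.Ising3DConformalLimit.Theses.LogPolarProxy.ExistsContinuousLimit ↔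
      Summit.CriticalPhenomena.Ising3DConformalLimit.Theses.HyperoctahedralRP.ExistsScaleCovariantLimit := by
  refine ⟨?_, existsContinuousLimit_of_existsScaleCovariantLimit⟩
  rintro ⟨ρ, Δ, S, hρ, hΔ, hlim, hzero, -, hnd, htr, hsc⟩
  exact ⟨ρ, Δ, S, hρ, hΔ, hlim, hzero, hnd, htr, hsc⟩

/-- The `ReflectionTwin` copy of the crux is the same proposition (the item is shared verbatim), hence
also equivalent to stmt-CriticalPhenomena-1981:
`ReflectionTwin.ExistsContinuousLimit ↔ HyperoctahedralRP.ExistsScaleCovariantLimit`. -/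
theorem reflectionTwin_existsContinuousLimit_iff_existsScaleCovariantLimit :
    Summit.CriticalPhenomena.Ising3DConformalLimit.Theses.ReflectionTwin.ExistsContinuousLimit ↔
      Summit.CriticalPhenomena.Ising3DConformalLimit.Theses.HyperoctahedralRP.ExistsScaleCovariantLimit :=
  existsContinuousLimit_iff_existsScaleCovariantLimit

end Summit.CriticalPhenomena.Ising3DConformalLimit.LogPolarProxyExistsContinuousLimit

end
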